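import Summits.AtomisticToContinuum.HydrodynamicLimit.Theorems.OneFlightGossipEngineKineticCurrentsWindowLDUniformFibreExpMoment

/-!
# `EquilibriumShearWindowLD`: the static exponential moment of the kinetic shear stress
# (route TwoClocks, stmt-AtomisticToContinuum-14446; static sandwich, part 3 — the Gaussian value)

Helper file (`--supports` stmt-AtomisticToContinuum-14446). The window exponential moment of the
item is dominated by the STATIC one, `∫ exp(β ∑ᵢ φ(xᵢ) vᵢ⁰ vᵢ¹) dG_N`
(`shearWindowMoment_le_static`, `TwoClocksEquilibriumShearWindowLDStatic.lean`). Here that static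
moment is evaluated: given the positions, the velocities under the global Gibbs law at rest are
independent Maxwellians `N(0, θ·id)` (disintegration `stub_fibreExpMoment` /
`lintegral_localGibbsMeasure`), and the one-particle moment is an explicit Gaussian integral.

* `lintegral_exp_mul_sq_gaussianReal` — `∫ e^{a x²} dN(0,1) = (1 - 2a)^{-1/2}` (`2a < 1`);
  `lintegral_exp_mul_gaussianReal` — `∫ e^{t x} dN(0,1) = e^{t²/2}` (Mathlib's `mgf`);
* `lintegral_exp_mul_coord_mul_coord_stdGaussian` — `∫ e^{t w⁰ w¹} dγ₃(w) = (1 - t²)^{-1/2}`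
  (`t² < 1`): independent coordinates (`map_pi_eq_stdGaussian`, `measurePreserving_piFinSuccAbove`),
  integrate `w⁰` out by the moment generating function, then the quadratic moment in `w¹`;
* `lintegral_exp_mul_shear_gaussMeasure` — `∫ e^{s v⁰ v¹} dN(0, θ·id)(v) = (1 - s²θ²)^{-1/2}`;
* `shearStaticMoment_le` — for continuous `|φ| ≤ M` and `β²M²θ² < 1`:
  `∫ exp(β ∑ᵢ φ(xᵢ) vᵢ⁰ vᵢ¹) dG_N ≤ (1 - β²M²θ²)^{-(N+1)/2}` for every `N` and every flow (exact for
  constant `φ`): the static pressure of the kinetic shear stress is at most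
  `-½ log(1 - β²M²θ²) = ½ β²M²θ² + O(β⁴)` per particle — quadratic in `β`, as it must be for a centred
  observable, and finite exactly in the Gaussian range `|β| M θ < 1`.

References: H. Spohn, *Large Scale Dynamics of Interacting Particles* (1991), Part I §2.3 (local
equilibrium states: Maxwellian velocities independent of the hard-core positions).

prover-pitem-stmt-AtomisticToContinuum-14446-1.
-/

noncomputable section

open MeasureTheory ProbabilityTheory Real Set
open scoped ENNReal NNReal

namespace Summit.AtomisticToContinuum.HydrodynamicLimit.Theorems

open Literature.Analysis.FluidPDE Literature.MathematicalPhysics.KineticTheory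

/-! ### One dimension: `E exp(a X²) = (1 - 2a)^{-1/2}` for `X ∼ N(0,1)`, `2a < 1` -/

/-- **Quadratic exponential moment of the standard real Gaussian**: for `2a < 1`,
`∫ exp(a x²) dN(0,1)(x) = (1 - 2a)^{-1/2}` (Gaussian integral `∫ e^{-b x²} dx = √(π/b)` with
`b = ½ - a`), in `lintegral` form. [folklore] -/
theorem lintegral_exp_mul_sq_gaussianReal {a : ℝ} (ha : 2 * a < 1) :
    ∫⁻ x, ENNReal.ofReal (Real.exp (a * x ^ 2)) ∂(gaussianReal 0 1) =
      ENNReal.ofReal ((1 - 2 * a) ^ (-(1 / 2 : ℝ))) := by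
  have hb : 0 < 1 / 2 - a := by linarith
  have h12 : 0 < 1 - 2 * a := by linarith
  -- the density form of the integrand
  have hdens : ∀ x : ℝ, gaussianPDFReal 0 1 x * Real.exp (a * x ^ 2) =
      (Real.sqrt (2 * π))⁻¹ * Real.exp (-(1 / 2 - a) * x ^ 2) := by
    intro x
    rw [gaussianPDFReal_def]
    simp only [NNReal.coe_one, mul_one, sub_zero]
    rw [mul_assoc, ← Real.exp_add]
    congr 2
    ring
  -- integrability against `N(0,1)` via the density
  have hint : Integrable (fun x : ℝ => Real.exp (a * x ^ 2)) (gaussianReal 0 1) := by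
    rw [gaussianReal_of_var_ne_zero 0 one_ne_zero,
      integrable_withDensity_iff_integrable_smul' (measurable_gaussianPDF 0 1)
        (ae_of_all _ fun _ => gaussianPDF_lt_top)]
    have h : (fun x : ℝ => (gaussianPDF 0 1 x).toReal • Real.exp (a * x ^ 2)) =
        fun x => (Real.sqrt (2 * π))⁻¹ * Real.exp (-(1 / 2 - a) * x ^ 2) := by
      funext x
      rw [toReal_gaussianPDF, smul_eq_mul, hdens]
    rw [h]
    exact (integrable_exp_neg_mul_sq hb).const_mul _
  -- the Bochner value
  have hval : ∫ x, Real.exp (a * x ^ 2) ∂(gaussianReal 0 1) = (1 - 2 * a) ^ (-(1 / 2 : ℝ)) := by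
    rw [integral_gaussianReal_eq_integral_smul one_ne_zero]
    simp_rw [smul_eq_mul, hdens]
    rw [integral_const_mul, integral_gaussian (1 / 2 - a)]
    -- `(√(2π))⁻¹ √(π/(½ - a)) = √((1 - 2a)⁻¹) = (1 - 2a)^{-1/2}`
    have hπ : 0 < π := Real.pi_pos
    have hid : (2 * π)⁻¹ * (π / (1 / 2 - a)) = (1 - 2 * a)⁻¹ := by
      field_simp
    rw [← Real.sqrt_inv, ← Real.sqrt_mul (inv_nonneg.2 (by positivity)), hid, Real.sqrt_eq_rpow,
      Real.inv_rpow h12.le, ← Real.rpow_neg h12.le]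
  rw [← ofReal_integral_eq_lintegral_ofReal hint (ae_of_all _ fun x => (Real.exp_pos _).le), hval]

/-- **Linear exponential moment of the standard real Gaussian** (`lintegral` form of the moment
generating function `mgf_fun_id_gaussianReal`): `∫ exp(t x) dN(0,1)(x) = exp(t²/2)`. [folklore] -/
theorem lintegral_exp_mul_gaussianReal (t : ℝ) :
    ∫⁻ x, ENNReal.ofReal (Real.exp (t * x)) ∂(gaussianReal 0 1) =
      ENNReal.ofReal (Real.exp (t ^ 2 / 2)) := by
  have h := congrFun (mgf_fun_id_gaussianReal (μ := 0) (v := 1)) t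
  simp only [mgf, NNReal.coe_one, one_mul, zero_mul, zero_add] at h
  rw [← ofReal_integral_eq_lintegral_ofReal (integrable_exp_mul_gaussianReal t)
    (ae_of_all _ fun x => (Real.exp_pos _).le), h]

/-! ### Three dimensions: `E exp(t w⁰ w¹) = (1 - t²)^{-1/2}` under the standard Gaussian -/

/-- **Exponential moment of the product of two coordinates under the standard Gaussian on `ℝ³`**:
for `t² < 1`, `∫ exp(t w⁰ w¹) dγ(w) = (1 - t²)^{-1/2}`. Proof: the coordinates are independent
standard Gaussians (`map_pi_eq_stdGaussian`); integrating out `w⁰` gives the moment generating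
function `exp(t² (w¹)²/2)` (`lintegral_exp_mul_gaussianReal`), and then
`∫ exp(t² x²/2) dN(0,1) = (1 - t²)^{-1/2}` (`lintegral_exp_mul_sq_gaussianReal`). [folklore] -/
theorem lintegral_exp_mul_coord_mul_coord_stdGaussian {t : ℝ} (ht : t ^ 2 < 1) :
    ∫⁻ w, ENNReal.ofReal (Real.exp (t * (w 0 * w 1))) ∂(stdGaussian V3) =
      ENNReal.ofReal ((1 - t ^ 2) ^ (-(1 / 2 : ℝ))) := by
  set μ : Fin 3 → Measure ℝ := fun _ => gaussianReal 0 1 with hμ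
  -- coordinates: pull back to the product measure on `Fin 3 → ℝ`
  have hGm : Measurable fun w : V3 => ENNReal.ofReal (Real.exp (t * (w 0 * w 1))) := by
    fun_prop
  have h1 : ∫⁻ w, ENNReal.ofReal (Real.exp (t * (w 0 * w 1))) ∂(stdGaussian V3) =
      ∫⁻ x, ENNReal.ofReal (Real.exp (t * (x 0 * x 1))) ∂(Measure.pi μ) := by
    rw [hμ, ← map_pi_eq_stdGaussian, lintegral_map hGm (PiLp.continuous_toLp 2 _).measurable]
  rw [h1]
  -- split off coordinate `0`
  set e := MeasurableEquiv.piFinSuccAbove (fun _ : Fin 3 => ℝ) 0 with he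
  have hmp : MeasurePreserving e (Measure.pi μ)
      ((μ 0).prod (Measure.pi fun j : Fin 2 => μ (Fin.succAbove 0 j))) :=
    measurePreserving_piFinSuccAbove μ 0
  have h2 : ∫⁻ x, ENNReal.ofReal (Real.exp (t * (x 0 * x 1))) ∂(Measure.pi μ) =
      ∫⁻ p, ENNReal.ofReal (Real.exp ((t * p.2 0) * p.1))
        ∂((μ 0).prod (Measure.pi fun j : Fin 2 => μ (Fin.succAbove 0 j))) := by
    rw [← (hmp.symm e).lintegral_comp_emb e.symm.measurableEmbedding]
    refine lintegral_congr fun p => ?_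
    simp only [he, MeasurableEquiv.piFinSuccAbove_symm_apply, Fin.insertNthEquiv, Equiv.coe_fn_mk,
      Fin.insertNth_zero']
    rw [Fin.cons_zero, show (1 : Fin 3) = Fin.succ 0 from rfl, Fin.cons_succ]
    ring_nf
  rw [h2]
  -- Tonelli: integrate `p.1` first (moment generating function), then `p.2 0`
  have hHm : Measurable fun p : ℝ × (Fin 2 → ℝ) =>
      ENNReal.ofReal (Real.exp ((t * p.2 0) * p.1)) := by
    fun_prop
  rw [lintegral_prod_symm _ hHm.aemeasurable]
  have hinner : ∀ y : Fin 2 → ℝ, ∫⁻ x, ENNReal.ofReal (Real.exp ((t * y 0) * x)) ∂(μ 0) =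
      ENNReal.ofReal (Real.exp ((t ^ 2 / 2) * (y 0) ^ 2)) := by
    intro y
    rw [hμ, lintegral_exp_mul_gaussianReal]
    congr 2
    ring
  simp_rw [hinner]
  -- the remaining integrand depends on coordinate `0` of `Fin 2 → ℝ` only
  have h3 : ∫⁻ y : Fin 2 → ℝ, ENNReal.ofReal (Real.exp ((t ^ 2 / 2) * (y 0) ^ 2))
        ∂(Measure.pi fun j : Fin 2 => μ (Fin.succAbove 0 j)) =
      ∫⁻ x, ENNReal.ofReal (Real.exp ((t ^ 2 / 2) * x ^ 2)) ∂(gaussianReal 0 1) := by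
    have hev := measurePreserving_eval (fun j : Fin 2 => μ (Fin.succAbove 0 j)) 0
    have hf : Measurable fun x : ℝ => ENNReal.ofReal (Real.exp ((t ^ 2 / 2) * x ^ 2)) := by
      fun_prop
    exact hev.lintegral_comp hf
  rw [h3, lintegral_exp_mul_sq_gaussianReal (by linarith)]
  congr 2
  ring

/-- **Exponential moment of the kinetic shear stress under the Maxwellian** `N(0, θ·id)` on `ℝ³`
(`gaussMeasure 0 θ`): for `θ > 0` and `s²θ² < 1`, `∫ exp(s v⁰ v¹) dN(0,θ)(v) = (1 - s²θ²)^{-1/2}`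
(scale `v = √θ w`, `lintegral_exp_mul_coord_mul_coord_stdGaussian` at `t = sθ`). [folklore] -/
theorem lintegral_exp_mul_shear_gaussMeasure {θ s : ℝ} (hθ : 0 < θ) (hs : s ^ 2 * θ ^ 2 < 1) :
    ∫⁻ v, ENNReal.ofReal (Real.exp (s * (v 0 * v 1))) ∂(gaussMeasure (0 : V3) θ) =
      ENNReal.ofReal ((1 - s ^ 2 * θ ^ 2) ^ (-(1 / 2 : ℝ))) := by
  have hGm : Measurable fun w : V3 => ENNReal.ofReal (Real.exp (s * (w 0 * w 1))) := by
    fun_prop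
  unfold gaussMeasure
  rw [lintegral_map hGm (measurable_gaussShift (0 : V3) θ)]
  have hsq : Real.sqrt θ * Real.sqrt θ = θ := Real.mul_self_sqrt hθ.le
  have h : ∀ w : V3, s * (((0 : V3) + Real.sqrt θ • w) 0 * (((0 : V3) + Real.sqrt θ • w) 1)) =
      (s * θ) * (w 0 * w 1) := by
    intro w
    simp only [zero_add, PiLp.smul_apply, smul_eq_mul]
    calc s * (Real.sqrt θ * w 0 * (Real.sqrt θ * w 1))
        = s * (Real.sqrt θ * Real.sqrt θ) * (w 0 * w 1) := by ring
      _ = (s * θ) * (w 0 * w 1) := by rw [hsq]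
  simp_rw [h]
  rw [lintegral_exp_mul_coord_mul_coord_stdGaussian (by nlinarith)]
  congr 2
  ring

/-! ### The static exponential moment of the kinetic shear stress under the Gibbs law -/

/-- **Static exponential moment of the kinetic shear stress under the global Gibbs law at rest.**
For `a, θ > 0`, `0 < σ ≤ 1/2`, a continuous `φ` with `|φ| ≤ Φ∞` and `β² Φ∞² θ² < 1`:
`∫ exp(β ∑ᵢ φ(xᵢ) vᵢ⁰ vᵢ¹) dG_N ≤ (1 - β²Φ∞²θ²)^{-(N+1)/2}` for every `N` and every flow.
Given the positions the velocities are independent Maxwellians (`stub_fibreExpMoment`, the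
disintegration of the local Gibbs measure), each fibre contributes the exact Gaussian moment
`(1 - β²φ(xᵢ)²θ²)^{-1/2} ≤ (1 - β²Φ∞²θ²)^{-1/2}` (`lintegral_exp_mul_shear_gaussMeasure`). For
constant `φ` the bound is the exact value. [folklore] -/
theorem shearStaticMoment_le {a θ : ℝ} (ha : 0 < a) (hθ : 0 < θ) {σ : ℝ} (hσ : 0 < σ)
    (hσ2 : σ ≤ 1 / 2) (N : ℕ)
    (Φ : HardSphereFlow (Torus.geometry (Fin 3)) (hsDiameter σ N) (N + 1))
    {φ : T3 → ℝ} (hφ : Continuous φ) {M : ℝ} (hM : ∀ x, |φ x| ≤ M) {β : ℝ}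
    (hβ : β ^ 2 * M ^ 2 * θ ^ 2 < 1) :
    ∫⁻ z, ENNReal.ofReal (Real.exp (β * ∑ i : Fin (N + 1), φ (z i).1 * ((z i).2 0 * (z i).2 1)))
        ∂(localGibbsLaw σ (fun _ => a) (fun _ => 0) (fun _ => θ) N Φ) ≤
      ENNReal.ofReal ((1 - β ^ 2 * M ^ 2 * θ ^ 2) ^ (-(1 / 2 : ℝ))) ^ (N + 1) := by
  -- the one-body factor and its fibre bound
  set g : T3 × V3 → ℝ≥0∞ := fun y => ENNReal.ofReal (Real.exp ((β * φ y.1) * (y.2 0 * y.2 1)))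
    with hg
  have hgm : Measurable g := by
    have hφm : Measurable φ := hφ.measurable
    simp only [hg]
    fun_prop
  have hK1 : 0 < 1 - β ^ 2 * M ^ 2 * θ ^ 2 := by linarith
  have hfib : ∀ x : T3, ∫⁻ v, g (x, v) * ENNReal.ofReal (localMaxwellian 1 θ (0 : V3) v) ≤
      ENNReal.ofReal ((1 - β ^ 2 * M ^ 2 * θ ^ 2) ^ (-(1 / 2 : ℝ))) := by
    intro x
    have hgx : Measurable fun v : V3 => g (x, v) := hgm.comp measurable_prodMk_left
    have hMx : Measurable fun v : V3 => ENNReal.ofReal (localMaxwellian 1 θ (0 : V3) v) :=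
      (continuous_localMaxwellian 1 θ (0 : V3)).measurable.ennreal_ofReal
    have hsx : (β * φ x) ^ 2 * θ ^ 2 ≤ β ^ 2 * M ^ 2 * θ ^ 2 := by
      have h1 : (φ x) ^ 2 ≤ M ^ 2 := by
        have := hM x
        rw [← sq_abs (φ x)]
        exact pow_le_pow_left₀ (abs_nonneg _) this 2
      nlinarith [sq_nonneg β, sq_nonneg θ, mul_nonneg (sq_nonneg β) (sq_nonneg θ)]
    calc ∫⁻ v, g (x, v) * ENNReal.ofReal (localMaxwellian 1 θ (0 : V3) v)
        = ∫⁻ v, g (x, v) ∂((volume : Measure V3).withDensity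
            fun v => ENNReal.ofReal (localMaxwellian 1 θ (0 : V3) v)) := by
          rw [lintegral_withDensity_eq_lintegral_mul _ hMx hgx]
          exact lintegral_congr fun v => mul_comm _ _
      _ = ∫⁻ v, g (x, v) ∂gaussMeasure (0 : V3) θ := by
          rw [withDensity_localMaxwellian_eq_gaussMeasure hθ (0 : V3)]
      _ = ENNReal.ofReal ((1 - (β * φ x) ^ 2 * θ ^ 2) ^ (-(1 / 2 : ℝ))) := by
          simp only [hg]
          exact lintegral_exp_mul_shear_gaussMeasure hθ (hsx.trans_lt hβ)
      _ ≤ ENNReal.ofReal ((1 - β ^ 2 * M ^ 2 * θ ^ 2) ^ (-(1 / 2 : ℝ))) := by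
          refine ENNReal.ofReal_le_ofReal ?_
          exact Real.rpow_le_rpow_of_nonpos hK1 (by linarith) (by norm_num)
  -- disintegrate the Gibbs law
  have hmain := KineticCurrentsWindowLDUniformSketch.stub_fibreExpMoment (fun _ => a) (fun _ => θ)
    (fun _ => (0 : V3)) continuous_const continuous_const continuous_const (fun _ => ha)
    (fun _ => hθ) σ hσ hσ2 N g hgm _ hfib
  rw [localGibbsLaw_eq]
  refine le_of_eq_of_le (lintegral_congr fun z => ?_) hmain
  rw [Finset.mul_sum, Real.exp_sum, ENNReal.ofReal_prod_of_nonneg (fun i _ => (Real.exp_pos _).le)]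
  refine Finset.prod_congr rfl fun i _ => ?_
  simp only [hg]
  ring_nf

end Summit.AtomisticToContinuum.HydrodynamicLimit.Theorems

end
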